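import Literature.AlgebraicGeometry.RealAlgebraic.ComplexOrientationFormulaFibreSumBoundary
import Literature.AlgebraicGeometry.RealAlgebraic.ComplexOrientationFormulaSlices
import Literature.AlgebraicGeometry.RealAlgebraic.ComplexOrientationFormulaHalfSheet
import Literature.AlgebraicGeometry.RealAlgebraic.ComplexOrientationFormulaAssemblyLemmas
import Literature.AlgebraicGeometry.RealAlgebraic.ComplexOrientationFormulaProofs
import HarnessLib

/-!
# Rokhlin's complex orientation formula, integrated form: the proof

Sibling proof file of `ComplexOrientationFormula.lean` (topic
`Literature/AlgebraicGeometry/RealAlgebraic`): the discharge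
`rokhlin_sum_sign_mul_area_ovalInterior_mem_algebraic_mul_pi_holds` of the named fact
`rokhlin_sum_sign_mul_area_ovalInterior_mem_algebraic_mul_pi` (Rokhlin 1974, §§2–3: the real
locus with its complex orientations bounds a half; integrated against the algebraic form `x dy`).
Everything here is PROVED; no definition and no named fact is introduced.

## The argument (Rokhlin's `∂H̄ = ℝA`, read slice by slice)

Let `p ∈ ℚ[x, y]` be geometrically irreducible, nonsingular, with compact real locus, dividing,
and let `H` be a half. After a rational shear `x = ξ + c y` the polynomial becomes, up to a
rational constant, a monic `Q ∈ ℚ[ξ][Y]`, irreducible over `ℂ`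
(`ComplexOrientationFormulaAssemblyLemmas`). For `ξ ∈ ℂ` let
`F(ξ) = Σ_{Q(ξ, y) = 0} η(ξ, y) · y`, `η = +1` on `H` and `-1` on `conj H` (the two halves
exhaust the non-real locus: `TwoHalves`). Then:

1. `F` is holomorphic on the upper half-plane `Im ξ > 0` (`ComplexOrientationFormulaFibreSum`),
   with boundary values `F(x + i0) = Σⱼ ηⱼ yⱼ(x)` at all but finitely many real `x`, where the
   non-real roots cancel in the real part by `conj`-symmetry and a REAL root `yⱼ(x)` — a point `v`
   of an oval `O` on the line `ξ = x` — carries the sign `ηⱼ = -halfSideSign(v) · sign(mⱼ)`,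
   `mⱼ = c ∂ₓp(v) + ∂_y p(v)` the transversality of the line to the oval
   (`ComplexOrientationFormulaFibreSumBoundary`, `ComplexOrientationFormulaHalfSheet`);
2. by Cavalieri, `Area(ovalInterior O) = ∫ λ(S_O(x)) dx` over the sheared lines, and the slice
   length is `λ(S_O(x)) = Σ_{v ∈ O ∩ line} sign(m_v) · gradOutwardSign(v) · y(v)`
   (`ComplexOrientationFormulaSlices`); with
   `complexOrientationSign p H O = halfSideSign · gradOutwardSign` (constant along `O`,
   `complexOrientationSign_isUnit_of_isDividing_holds`) this gives
   `Re F(x + i0) = -Σ_O complexOrientationSign(O) · λ(S_O(x))` for a.e. `x`;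
3. Cauchy's theorem on rectangles `[-R, R] × [δ, R]`, `δ → 0`
   (`Literature.Analysis.Complex.UpperHalfPlaneBoundaryContour`):
   `∫_{-R}^{R} F(x + i0) dx = T(F, R)`, the integral over the three other sides;
4. at infinity `F = Σ_v η_v ỹ_v` is a signed sum of convergent Puiseux branches with ALGEBRAIC
   coefficients (`Literature.FieldTheory.AlgClosed.PuiseuxAtInfinityAlgebraic`), whence
   `Re T(F, R) = Σᵢ cᵢ R^{qᵢ} + π Σ_v η_v Im a_{v,N+n} + o(1)` with `qᵢ > 0`
   (`Literature.Analysis.Complex.UpperHalfPlanePuiseuxContour`);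
5. the left side of 3. is eventually the constant `-Σ_O complexOrientationSign(O) · Area(O)`
   (compact real locus), so uniqueness of divergent expansions kills the `cᵢ` and
   `Σ_O complexOrientationSign p H O · Area(ovalInterior O) = -π Σ_v η_v Im a_{v,N+n}`,
   an algebraic multiple of `π`.

This replaces the residue theorem on the compact bordered surface `H̄` and Green's theorem of
the printed argument (neither is in Mathlib) by rectangle Cauchy, slices and fibre sums.

## References

* [Rokhlin1974] V. A. Rokhlin, Complex orientations of real algebraic curves, Funct. Anal.
  Appl. 8 (1974) 331–334, §§2–3.
* [DegtyarevKharlamov2000] A. Degtyarev, V. Kharlamov, Topological properties of real algebraic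
  varieties: du côté de chez Rokhlin, Russian Math. Surveys 55 (2000), §1.
-/

noncomputable section

open MvPolynomial Set Filter Metric Complex
open _root_.MeasureTheory
open scoped _root_.Topology _root_.ComplexConjugate Classical

namespace Literature.AlgebraicGeometry.RealAlgebraic

namespace Assembly

variable {p : MvPolynomial (Fin 2) ℚ}

/-! ### Real points of the sheared lines -/

/-- The complex point of the sheared line over a real parameter is the real point. [folklore] -/
theorem ofReal_linePt (c : ℚ) (x t : ℝ) :
    (fun j => (((![x + (c : ℝ) * t, t] : Fin 2 → ℝ) j : ℝ) : ℂ)) =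
      (![(x : ℂ) + (c : ℂ) * (t : ℂ), (t : ℂ)] : Fin 2 → ℂ) := by
  funext j
  fin_cases j <;> simp

/-- A real parameter is a complex zero on the sheared line iff it is a real zero. [folklore] -/
theorem aeval_linePt_eq_zero_iff (q : MvPolynomial (Fin 2) ℚ) (c : ℚ) (x t : ℝ) :
    aeval (![(x : ℂ) + (c : ℂ) * (t : ℂ), (t : ℂ)] : Fin 2 → ℂ) q = 0 ↔
      aeval (![x + (c : ℝ) * t, t] : Fin 2 → ℝ) q = 0 := by
  rw [← ofReal_linePt, aeval_ofReal, Complex.ofReal_eq_zero]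

/-- The complex partial derivatives at a real point of the sheared line are the real gradient.
[folklore] -/
theorem aeval_linePt_pderiv (p : MvPolynomial (Fin 2) ℚ) (c : ℚ) (x t : ℝ) (i : Fin 2) :
    aeval (![(x : ℂ) + (c : ℂ) * (t : ℂ), (t : ℂ)] : Fin 2 → ℂ) (pderiv i p) =
      ((realGrad p ![x + (c : ℝ) * t, t] i : ℝ) : ℂ) := by
  rw [← ofReal_linePt, aeval_ofReal, realGrad_apply]

/-! ### The sign carried by a real root -/

/-- **The sign of the upper half-sheet through a real root.** At a real zero `v = (x + ct, t)`
on the sheared line `ξ = x`, transversal to the oval (`m = c ∂ₓp(v) + ∂_y p(v) ≠ 0`), let `y` be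
the local sheet of fibre roots with `y(x) = t` and `η = ±1` the (constant) sign of the points
`(ξ + c y(ξ), y(ξ))`, `ξ = x + iτ`, `τ → 0⁺`; let `σ = ±1` be the crossing sign of the line at `v`
(`Slices.exists_sign_at_crossing`). Then `η = -complexOrientationSign(O_v) · σ`: the upper
half-sheet lies in `H` iff `halfSideSign(v) · m < 0` (`Sheets.upper_halfSheet_mem_iff`),
`σ = sign(m) · gradOutwardSign(v)`, and the oval sign is `halfSideSign · gradOutwardSign` at
every point of the oval (`complexOrientationSign_isUnit_of_isDividing_holds`).
[cite: Rokhlin1974, §2] -/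
theorem re_eta_eq (hcpt : IsCompact {v : Fin 2 → ℝ | aeval v p = 0})
    (hsm : ∀ w ∈ complexZeroLocus p, ∃ i, aeval w (pderiv i p) ≠ 0)
    (hirr : Irreducible (map (algebraMap ℚ ℂ) p)) (hdiv : IsDividing p)
    {H : Set (Fin 2 → ℂ)} (hH : IsHalf p H) {c : ℚ} {Q : Polynomial (Polynomial ℚ)}
    (hQp : ∀ ξ y : ℂ, (Q.map (Polynomial.eval₂RingHom (algebraMap ℚ ℂ) ξ)).eval y = 0 ↔
      aeval (![ξ + (c : ℂ) * y, y] : Fin 2 → ℂ) p = 0)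
    {x t : ℝ} {y : ℂ → ℂ} (hyd : DifferentiableAt ℂ y (x : ℂ)) (hyx : y (x : ℂ) = (t : ℂ))
    (hroot : ∀ᶠ ξ in 𝓝 (x : ℂ), (Q.map (Polynomial.eval₂RingHom (algebraMap ℚ ℂ) ξ)).eval (y ξ) = 0)
    (hm : realGrad p ![x + (c : ℝ) * t, t] 0 * (c : ℝ) + realGrad p ![x + (c : ℝ) * t, t] 1 ≠ 0)
    {η : ℂ}
    (hupper : ∀ᶠ τ : ℝ in 𝓝[>] 0,
      (if (![((x : ℂ) + (τ : ℂ) * I) + (c : ℂ) * y ((x : ℂ) + (τ : ℂ) * I),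
        y ((x : ℂ) + (τ : ℂ) * I)] : Fin 2 → ℂ) ∈ H then (1 : ℂ) else -1) = η)
    {σ : ℤ} (hσ1 : σ = 1 ∨ σ = -1)
    (hσpos : 0 < ∑ i, realGrad p ![x + (c : ℝ) * t, t] i * (![(c : ℝ), 1] : Fin 2 → ℝ) i →
      gradOutwardSign p (connectedComponentIn {u : Fin 2 → ℝ | aeval u p = 0} ![x + (c : ℝ) * t, t])
        ![x + (c : ℝ) * t, t] = σ)
    (hσneg : ∑ i, realGrad p ![x + (c : ℝ) * t, t] i * (![(c : ℝ), 1] : Fin 2 → ℝ) i < 0 →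
      gradOutwardSign p (connectedComponentIn {u : Fin 2 → ℝ | aeval u p = 0} ![x + (c : ℝ) * t, t])
        ![x + (c : ℝ) * t, t] = -σ) :
    η.re = -((complexOrientationSign p H
      (connectedComponentIn {u : Fin 2 → ℝ | aeval u p = 0} ![x + (c : ℝ) * t, t]) : ℝ) * σ) := by
  have hcC : ((c : ℝ) : ℂ) = (c : ℂ) := Complex.ofReal_ratCast c
  -- `v = (x + ct, t)` is a real zero
  have hvZ : aeval (![x + (c : ℝ) * t, t] : Fin 2 → ℝ) p = 0 := by
    have h0 := hroot.self_of_nhds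
    rw [hyx, hQp] at h0
    rwa [aeval_linePt_eq_zero_iff] at h0
  have hA := isConnected_complexZeroLocus hirr
  -- the side sign at `v` is `±1`
  obtain ⟨s, hs1, W, -, hvW, hW⟩ :=
    halfSideSign_locallyConstant p hA.isPreconnected hsm hdiv hH hvZ
  have hss : halfSideSign p H ![x + (c : ℝ) * t, t] = s := hW _ hvW hvZ
  -- the oval sign is `halfSideSign · gradOutwardSign` at `v`
  have hε : complexOrientationSign p H
      (connectedComponentIn {u : Fin 2 → ℝ | aeval u p = 0} ![x + (c : ℝ) * t, t]) =
      s * gradOutwardSign p (connectedComponentIn {u : Fin 2 → ℝ | aeval u p = 0} ![x + (c : ℝ) * t, t])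
        ![x + (c : ℝ) * t, t] := by
    have hne : complexOrientationSign p H
        (connectedComponentIn {u : Fin 2 → ℝ | aeval u p = 0} ![x + (c : ℝ) * t, t]) ≠ 0 := by
      rcases complexOrientationSign_isUnit_of_isDividing_holds p hcpt hsm hirr hdiv H hH _ hvZ with
        h | h <;> simp [h]
    rw [← complexOrientationSignAt_eq_of_ne_zero p hne (mem_connectedComponentIn hvZ),
      complexOrientationSignAt, hss]
  -- the upper half-sheet lies in `H` iff `s · m < 0`
  have hyreal : (y x).im = 0 := by rw [hyx, Complex.ofReal_im]
  have hyre : (y x).re = t := by rw [hyx, Complex.ofReal_re]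
  have hroot' : ∀ᶠ ξ in 𝓝 (x : ℂ),
      aeval (![ξ + ((c : ℝ) : ℂ) * y ξ, y ξ] : Fin 2 → ℂ) p = 0 := by
    filter_upwards [hroot] with ξ hξ
    rw [hcC]
    exact (hQp ξ _).1 hξ
  have hm' : realGrad p ![x + (c : ℝ) * (y x).re, (y x).re] 0 * (c : ℝ) +
      realGrad p ![x + (c : ℝ) * (y x).re, (y x).re] 1 ≠ 0 := by
    rw [hyre]; exact hm
  have hhs' : halfSideSign p H ![x + (c : ℝ) * (y x).re, (y x).re] = 1 ∨
      halfSideSign p H ![x + (c : ℝ) * (y x).re, (y x).re] = -1 := by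
    rw [hyre, hss]; exact hs1
  have hpath : Tendsto (fun τ : ℝ => (x : ℂ) + (τ : ℂ) * I) (𝓝[>] 0) (𝓝 (x : ℂ)) := by
    have hc : Continuous (fun τ : ℝ => (x : ℂ) + (τ : ℂ) * I) := by fun_prop
    have h := hc.tendsto 0
    simp only [Complex.ofReal_zero, zero_mul, add_zero] at h
    exact h.mono_left nhdsWithin_le_nhds
  have hN' : ∀ᶠ τ : ℝ in 𝓝[>] 0,
      (![((x : ℂ) + (τ : ℂ) * I) + ((c : ℝ) : ℂ) * y ((x : ℂ) + (τ : ℂ) * I),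
        y ((x : ℂ) + (τ : ℂ) * I)] : Fin 2 → ℂ) ∈ nonRealLocus p := by
    filter_upwards [hpath.eventually hroot, self_mem_nhdsWithin] with τ hτ hτpos
    rw [hcC]
    exact Sheets.mem_nonRealLocus_of_im_pos hQp (by simpa using hτpos) hτ
  have hHS := Sheets.upper_halfSheet_mem_iff p (c : ℝ) x hyd hyreal hroot' hm' hhs' hN'
  obtain ⟨τ, hτ1, hτ2⟩ := (hupper.and hHS).exists
  rw [hcC, hyre, hss] at hτ2
  have hsum : ∑ i, realGrad p ![x + (c : ℝ) * t, t] i * (![(c : ℝ), 1] : Fin 2 → ℝ) i =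
      realGrad p ![x + (c : ℝ) * t, t] 0 * (c : ℝ) + realGrad p ![x + (c : ℝ) * t, t] 1 := by
    simp [Fin.sum_univ_two]
  rw [hsum] at hσpos hσneg
  rw [hε]
  rcases lt_or_gt_of_ne hm with hneg | hpos
  · rw [hσneg hneg]
    rcases hs1 with rfl | rfl
    · have hin := hτ2.2 (by push_cast; linarith)
      rw [if_pos hin] at hτ1
      rw [← hτ1]
      rcases hσ1 with rfl | rfl <;> norm_num
    · have hout : (![((x : ℂ) + (τ : ℂ) * I) + (c : ℂ) * y ((x : ℂ) + (τ : ℂ) * I),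
          y ((x : ℂ) + (τ : ℂ) * I)] : Fin 2 → ℂ) ∉ H := by
        intro hin
        have := hτ2.1 hin
        push_cast at this
        linarith
      rw [if_neg hout] at hτ1
      rw [← hτ1]
      rcases hσ1 with rfl | rfl <;> norm_num
  · rw [hσpos hpos]
    rcases hs1 with rfl | rfl
    · have hout : (![((x : ℂ) + (τ : ℂ) * I) + (c : ℂ) * y ((x : ℂ) + (τ : ℂ) * I),
          y ((x : ℂ) + (τ : ℂ) * I)] : Fin 2 → ℂ) ∉ H := by
        intro hin
        have := hτ2.1 hin
        push_cast at this
        linarith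
      rw [if_neg hout] at hτ1
      rw [← hτ1]
      rcases hσ1 with rfl | rfl <;> norm_num
    · have hin := hτ2.2 (by push_cast; linarith)
      rw [if_pos hin] at hτ1
      rw [← hτ1]
      rcases hσ1 with rfl | rfl <;> norm_num

/-! ### The real part of the boundary value at a good point -/

/-- **Boundary values of the signed fibre sum versus slice lengths.** At a real `x` over which
the fibre is simple (`g(x) ≠ 0` for a Bézout element `g`), the signed fibre sum `F` has a limit
`L` from the upper half-plane and
`Re L = -Σ_O complexOrientationSign p H O · λ{t | (x + ct, t) ∈ ovalInterior O}`:
the non-real roots cancel (`Sheets.re_sum_sheets_eq`), each real root carries the sign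
`-complexOrientationSign · σ` (`re_eta_eq`), and the slice of the inside of each oval has length
`Σ σ t` over its crossings (`Slices.volume_slice_toReal_eq_sum`). [cite: Rokhlin1974, §§2–3] -/
theorem exists_boundaryValue_re (hcpt : IsCompact {v : Fin 2 → ℝ | aeval v p = 0})
    (hsm : ∀ w ∈ complexZeroLocus p, ∃ i, aeval w (pderiv i p) ≠ 0)
    (hirr : Irreducible (map (algebraMap ℚ ℂ) p)) (hdiv : IsDividing p)
    {H : Set (Fin 2 → ℂ)} (hH : IsHalf p H) (hN : nonRealLocus p = H ∪ star '' H)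
    (hdisj : Disjoint H (star '' H)) {c : ℚ} {Q : Polynomial (Polynomial ℚ)} (hmonic : Q.Monic)
    (hQp : ∀ ξ y : ℂ, (Q.map (Polynomial.eval₂RingHom (algebraMap ℚ ℂ) ξ)).eval y = 0 ↔
      aeval (![ξ + (c : ℂ) * y, y] : Fin 2 → ℂ) p = 0)
    (hQder : ∀ ξ y : ℂ, (c : ℂ) * aeval (![ξ + (c : ℂ) * y, y] : Fin 2 → ℂ) (pderiv 0 p) +
        aeval (![ξ + (c : ℂ) * y, y] : Fin 2 → ℂ) (pderiv 1 p) = 0 →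
      (Polynomial.derivative (Q.map (Polynomial.eval₂RingHom (algebraMap ℚ ℂ) ξ))).eval y = 0)
    {F : ℂ → ℂ}
    (hF : ∀ ξ : ℂ, F ξ = (((Q.map (Polynomial.eval₂RingHom (algebraMap ℚ ℂ) ξ)).roots.map fun y =>
      (if (![ξ + (c : ℂ) * y, y] : Fin 2 → ℂ) ∈ H then (1 : ℂ) else -1) * y)).sum)
    {A B : Polynomial (Polynomial ℚ)} {g : Polynomial ℚ}
    (hbez : A * Q + B * Polynomial.derivative Q = Polynomial.C g)
    {x : ℝ} (hg : Polynomial.aeval (x : ℂ) g ≠ 0) :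
    ∃ L : ℂ, Tendsto F (𝓝[{z : ℂ | 0 < z.im}] (x : ℂ)) (𝓝 L) ∧
      L.re = -∑ O ∈ (finite_setOf_oval p).toFinset, (complexOrientationSign p H O : ℝ) *
        (volume {t : ℝ | (![x + (c : ℝ) * t, t] : Fin 2 → ℝ) ∈ ovalInterior O}).toReal := by
  obtain ⟨ε, hε, y, η, hya, hyinj, hroots, hη, hup, hηnr, hlim⟩ :=
    Sheets.exists_sheets_tendsto_fibreSum_real hH hN hdisj hmonic hQp hF hbez hg
  refine ⟨_, hlim, ?_⟩
  have hxball : (x : ℂ) ∈ ball (x : ℂ) ε := mem_ball_self hε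
  rw [Sheets.re_sum_sheets_eq hN hdisj hmonic hQp (hyinj _ hxball) (hroots _ hxball) hη hηnr]
  have hfib0 : ∀ ξ : ℂ, Q.map (Polynomial.eval₂RingHom (algebraMap ℚ ℂ) ξ) ≠ 0 := fun ξ =>
    (hmonic.map _).ne_zero
  -- the sheet values are fibre roots
  have hyroot : ∀ j, ∀ ξ ∈ ball (x : ℂ) ε,
      (Q.map (Polynomial.eval₂RingHom (algebraMap ℚ ℂ) ξ)).eval (y j ξ) = 0 := by
    intro j ξ hξ
    have hmem : y j ξ ∈ (Q.map (Polynomial.eval₂RingHom (algebraMap ℚ ℂ) ξ)).roots := by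
      rw [hroots ξ hξ]
      exact Multiset.mem_map.2 ⟨j, Finset.mem_univ_val j, rfl⟩
    exact (Polynomial.mem_roots (hfib0 ξ)).1 hmem
  -- real sheet values at `x`: real zeros, transversal crossings
  have hyx : ∀ j, (y j x).im = 0 → y j x = (((y j x).re : ℝ) : ℂ) := fun j hj => by
    apply Complex.ext <;> simp [hj]
  have hvZ : ∀ j, (y j x).im = 0 →
      aeval (![x + (c : ℝ) * (y j x).re, (y j x).re] : Fin 2 → ℝ) p = 0 := by
    intro j hj
    have h := hyroot j _ hxball
    rw [hyx j hj, hQp, aeval_linePt_eq_zero_iff] at h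
    exact h
  have hm : ∀ j, (y j x).im = 0 →
      realGrad p ![x + (c : ℝ) * (y j x).re, (y j x).re] 0 * (c : ℝ) +
        realGrad p ![x + (c : ℝ) * (y j x).re, (y j x).re] 1 ≠ 0 := by
    intro j hj hm0
    have hder : (Polynomial.derivative
        (Q.map (Polynomial.eval₂RingHom (algebraMap ℚ ℂ) (x : ℂ)))).eval (y j x) = 0 := by
      apply hQder
      rw [hyx j hj, aeval_linePt_pderiv, aeval_linePt_pderiv]
      have h := congrArg (fun r : ℝ => (r : ℂ)) hm0
      push_cast at h
      linear_combination h
    exact hg (Sheets.aeval_eq_zero_of_isRoot_of_isRoot_derivative hbez (hyroot j _ hxball) hder)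
  -- regularity of the real locus, crossing signs
  have hreg : ∀ u : Fin 2 → ℝ, aeval u p = 0 → realGrad p u ≠ 0 := fun u hu => realGrad_ne_zero hsm hu
  have hsumf : ∀ t : ℝ, ∑ i, realGrad p ![x + (c : ℝ) * t, t] i * (![(c : ℝ), 1] : Fin 2 → ℝ) i =
      realGrad p ![x + (c : ℝ) * t, t] 0 * (c : ℝ) + realGrad p ![x + (c : ℝ) * t, t] 1 := by
    intro t
    simp [Fin.sum_univ_two]
  -- the index set of real roots
  obtain ⟨J, hJ⟩ : ∃ J : Finset (Fin Q.natDegree), ∀ j, j ∈ J ↔ (y j x).im = 0 :=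
    ⟨Finset.univ.filter fun j => (y j x).im = 0, fun j => by simp⟩
  trans ∑ j ∈ J, (η j).re * (y j x).re
  · exact Finset.sum_congr (Finset.ext fun j => by simp [hJ]) (fun _ _ => rfl)
  -- the real parameters `t = Re yⱼ(x)`, `j ∈ J`, are exactly the real zeros on the line
  have htZ : ∀ t ∈ J.image (fun j => (y j x).re), aeval (![x + (c : ℝ) * t, t] : Fin 2 → ℝ) p = 0 := by
    intro t ht
    obtain ⟨j, hj, rfl⟩ := Finset.mem_image.1 ht
    exact hvZ j ((hJ j).1 hj)
  have hZt : ∀ t : ℝ, aeval (![x + (c : ℝ) * t, t] : Fin 2 → ℝ) p = 0 →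
      t ∈ J.image (fun j => (y j x).re) := by
    intro t ht
    rw [← aeval_linePt_eq_zero_iff, ← hQp] at ht
    have hmem : (t : ℂ) ∈ (Q.map (Polynomial.eval₂RingHom (algebraMap ℚ ℂ) (x : ℂ))).roots :=
      (Polynomial.mem_roots (hfib0 _)).2 ht
    rw [hroots _ hxball, Multiset.mem_map] at hmem
    obtain ⟨j, -, hj⟩ := hmem
    have hjr : (y j x).im = 0 := by rw [hj, Complex.ofReal_im]
    refine Finset.mem_image.2 ⟨j, (hJ j).2 hjr, ?_⟩
    rw [hj, Complex.ofReal_re]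
  have htm : ∀ t ∈ J.image (fun j => (y j x).re),
      realGrad p ![x + (c : ℝ) * t, t] 0 * (c : ℝ) + realGrad p ![x + (c : ℝ) * t, t] 1 ≠ 0 := by
    intro t ht
    obtain ⟨j, hj, rfl⟩ := Finset.mem_image.1 ht
    exact hm j ((hJ j).1 hj)
  -- crossing signs `σ t`
  have hσex : ∀ t : ℝ, ∃ σ : ℤ, t ∈ J.image (fun j => (y j x).re) →
      (σ = 1 ∨ σ = -1) ∧
      (∀ᶠ s in 𝓝[>] (0 : ℝ),
        ((![x + (c : ℝ) * (t - s), t - s] : Fin 2 → ℝ) ∈ ovalInterior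
            (connectedComponentIn {u : Fin 2 → ℝ | aeval u p = 0} ![x + (c : ℝ) * t, t]) ↔ σ = 1) ∧
        ((![x + (c : ℝ) * (t + s), t + s] : Fin 2 → ℝ) ∈ ovalInterior
            (connectedComponentIn {u : Fin 2 → ℝ | aeval u p = 0} ![x + (c : ℝ) * t, t]) ↔ σ = -1)) ∧
      (0 < ∑ i, realGrad p ![x + (c : ℝ) * t, t] i * (![(c : ℝ), 1] : Fin 2 → ℝ) i →
        gradOutwardSign p (connectedComponentIn {u : Fin 2 → ℝ | aeval u p = 0} ![x + (c : ℝ) * t, t])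
          ![x + (c : ℝ) * t, t] = σ) ∧
      (∑ i, realGrad p ![x + (c : ℝ) * t, t] i * (![(c : ℝ), 1] : Fin 2 → ℝ) i < 0 →
        gradOutwardSign p (connectedComponentIn {u : Fin 2 → ℝ | aeval u p = 0} ![x + (c : ℝ) * t, t])
          ![x + (c : ℝ) * t, t] = -σ) := by
    intro t
    by_cases ht : t ∈ J.image (fun j => (y j x).re)
    · obtain ⟨σ, h1, h2, h3, h4⟩ := Slices.exists_sign_at_crossing p hcpt hreg
        (v₀ := ![x + (c : ℝ) * t, t]) (ξ₀ := x) (c := (c : ℝ)) (y₀ := t)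
        (mem_connectedComponentIn (htZ t ht)) (by rw [hsumf]; exact htm t ht)
      exact ⟨σ, fun _ => ⟨h1, h2, h3, h4⟩⟩
    · exact ⟨1, fun h => absurd h ht⟩
  choose σ hσ using hσex
  -- each real root carries the sign `-complexOrientationSign · σ`
  have hsign : ∀ j ∈ J, (η j).re =
      -((complexOrientationSign p H (connectedComponentIn {u : Fin 2 → ℝ | aeval u p = 0}
          ![x + (c : ℝ) * (y j x).re, (y j x).re]) : ℝ) * σ (y j x).re) := by
    intro j hj
    have hjr := (hJ j).1 hj
    have ht : (y j x).re ∈ J.image (fun j => (y j x).re) := Finset.mem_image_of_mem _ hj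
    obtain ⟨h1, -, h3, h4⟩ := hσ _ ht
    refine re_eta_eq hcpt hsm hirr hdiv hH hQp (hya j _ hxball).differentiableAt (hyx j hjr) ?_
      (hm j hjr) ?_ h1 h3 h4
    · filter_upwards [isOpen_ball.mem_nhds hxball] with ξ hξ using hyroot j ξ hξ
    · have hτball : ∀ᶠ τ : ℝ in 𝓝[>] 0, (x : ℂ) + (τ : ℂ) * I ∈ ball (x : ℂ) ε := by
        have hc : Continuous (fun τ : ℝ => (x : ℂ) + (τ : ℂ) * I) := by fun_prop
        have h := hc.tendsto 0
        simp only [Complex.ofReal_zero, zero_mul, add_zero] at h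
        exact nhdsWithin_le_nhds (h (isOpen_ball.mem_nhds hxball))
      filter_upwards [hτball, self_mem_nhdsWithin] with τ hτ hτpos
      exact hup j _ hτ (by simpa using hτpos)
  -- slice lengths of the insides of the ovals
  have hvol : ∀ O ∈ (finite_setOf_oval p).toFinset,
      (volume {t : ℝ | (![x + (c : ℝ) * t, t] : Fin 2 → ℝ) ∈ ovalInterior O}).toReal =
        ∑ t ∈ (J.image (fun j => (y j x).re)).filter
          (fun t => (![x + (c : ℝ) * t, t] : Fin 2 → ℝ) ∈ O), (σ t : ℝ) * t := by
    intro O hO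
    have hO' := (finite_setOf_oval p).mem_toFinset.1 hO
    have hOZ : O ⊆ {u : Fin 2 → ℝ | aeval u p = 0} := oval_subset_realLocus hO'
    refine Slices.volume_slice_toReal_eq_sum (isCompact_oval hcpt hO') _ (fun t => ?_) σ
      (fun t ht => ?_) (fun t ht => ?_)
    · refine ⟨fun htO => Finset.mem_filter.2 ⟨hZt t (hOZ htO), htO⟩,
        fun ht => (Finset.mem_filter.1 ht).2⟩
    · obtain ⟨ht1, ht2⟩ := Finset.mem_filter.1 ht
      obtain ⟨-, h2, -, -⟩ := hσ t ht1
      have hOt : connectedComponentIn {u : Fin 2 → ℝ | aeval u p = 0} ![x + (c : ℝ) * t, t] = O := by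
        obtain ⟨v, -, rfl⟩ := hO'
        exact (connectedComponentIn_eq ht2).symm
      rw [hOt] at h2
      exact h2
    · exact (hσ t (Finset.mem_filter.1 ht).1).1
  -- regrouping: sum over real roots = sum over ovals of sums over crossings
  have hinj : ∀ j ∈ J, ∀ j' ∈ J, (y j x).re = (y j' x).re → j = j' := by
    intro j hj j' hj' h
    have e1 := hyx j ((hJ j).1 hj)
    have e2 := hyx j' ((hJ j').1 hj')
    exact hyinj _ hxball (e1.trans ((by rw [h]) : (((y j x).re : ℝ) : ℂ) = (((y j' x).re : ℝ) : ℂ))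
      |>.trans e2.symm)
  calc ∑ j ∈ J, (η j).re * (y j x).re
      = ∑ j ∈ J, (fun t : ℝ => -((complexOrientationSign p H
          (connectedComponentIn {u : Fin 2 → ℝ | aeval u p = 0} ![x + (c : ℝ) * t, t]) : ℝ) *
            ((σ t : ℝ) * t))) (y j x).re := by
        refine Finset.sum_congr rfl fun j hj => ?_
        rw [hsign j hj]
        dsimp only
        ring
    _ = ∑ t ∈ J.image (fun j => (y j x).re), -((complexOrientationSign p H
          (connectedComponentIn {u : Fin 2 → ℝ | aeval u p = 0} ![x + (c : ℝ) * t, t]) : ℝ) *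
            ((σ t : ℝ) * t)) := by rw [Finset.sum_image hinj]
    _ = -∑ t ∈ J.image (fun j => (y j x).re), (complexOrientationSign p H
          (connectedComponentIn {u : Fin 2 → ℝ | aeval u p = 0} ![x + (c : ℝ) * t, t]) : ℝ) *
            ((σ t : ℝ) * t) := by rw [Finset.sum_neg_distrib]
    _ = -∑ O ∈ (finite_setOf_oval p).toFinset,
          ∑ t ∈ (J.image (fun j => (y j x).re)).filter
            (fun t => connectedComponentIn {u : Fin 2 → ℝ | aeval u p = 0} ![x + (c : ℝ) * t, t] = O),
            (complexOrientationSign p H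
              (connectedComponentIn {u : Fin 2 → ℝ | aeval u p = 0} ![x + (c : ℝ) * t, t]) : ℝ) *
              ((σ t : ℝ) * t) := by
        rw [Finset.sum_fiberwise_of_maps_to]
        intro t ht
        exact (finite_setOf_oval p).mem_toFinset.2 ⟨_, htZ t ht, rfl⟩
    _ = -∑ O ∈ (finite_setOf_oval p).toFinset, (complexOrientationSign p H O : ℝ) *
          ∑ t ∈ (J.image (fun j => (y j x).re)).filter
            (fun t => (![x + (c : ℝ) * t, t] : Fin 2 → ℝ) ∈ O), (σ t : ℝ) * t := by
        congr 1
        refine Finset.sum_congr rfl fun O hO => ?_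
        have hO' := (finite_setOf_oval p).mem_toFinset.1 hO
        have hiff : ∀ t ∈ J.image (fun j => (y j x).re),
            connectedComponentIn {u : Fin 2 → ℝ | aeval u p = 0} ![x + (c : ℝ) * t, t] = O ↔
              (![x + (c : ℝ) * t, t] : Fin 2 → ℝ) ∈ O := by
          intro t ht
          refine ⟨fun h => h ▸ mem_connectedComponentIn (htZ t ht), fun h => ?_⟩
          obtain ⟨v, -, rfl⟩ := hO'
          exact (connectedComponentIn_eq h).symm
        rw [Finset.filter_congr hiff, Finset.mul_sum]
        refine Finset.sum_congr rfl fun t ht => ?_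
        obtain ⟨ht1, ht2⟩ := Finset.mem_filter.1 ht
        rw [(hiff t ht1).2 ht2]
    _ = _ := by
        congr 1
        refine Finset.sum_congr rfl fun O hO => ?_
        rw [hvol O hO]

/-! ### Bounds and supports -/

/-- The holomorphic version `F'` of the fibre sum (equal to `F` off the finitely many bad
fibres) inherits the bounds of `F` on open sets, by continuity and density. [folklore] -/
theorem norm_extension_le {F F' : ℂ → ℂ} {g : Polynomial ℚ} (hg0 : g ≠ 0)
    (hF' : ContinuousOn F' {z : ℂ | 0 < z.im})
    (heq : ∀ z : ℂ, 0 < z.im → Polynomial.aeval z g ≠ 0 → F' z = F z)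
    {K : Set ℂ} (hK : IsOpen K) {B : ℝ} (hB : ∀ z ∈ K, ‖F z‖ ≤ B) {z : ℂ} (hz : 0 < z.im)
    (hzK : z ∈ K) : ‖F' z‖ ≤ B := by
  have hopen : IsOpen {z : ℂ | 0 < z.im} := isOpen_lt continuous_const Complex.continuous_im
  have hg0' : g.map (algebraMap ℚ ℂ) ≠ 0 :=
    (Polynomial.map_ne_zero_iff (algebraMap ℚ ℂ).injective).2 hg0
  have hTg : ∀ w : ℂ, w ∉ (g.map (algebraMap ℚ ℂ)).roots.toFinset → Polynomial.aeval w g ≠ 0 := by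
    intro w hw h0
    apply hw
    rw [Multiset.mem_toFinset, Polynomial.mem_roots hg0', Polynomial.IsRoot.def, Polynomial.eval_map,
      ← Polynomial.aeval_def]
    exact h0
  have hev : ∀ᶠ w in 𝓝[≠] z, ‖F' w‖ ≤ B := by
    have h3 : ∀ᶠ w in 𝓝 z, w ≠ z → w ∉ (g.map (algebraMap ℚ ℂ)).roots.toFinset := by
      have hfin : ((((g.map (algebraMap ℚ ℂ)).roots.toFinset : Finset ℂ) : Set ℂ) \ {z}).Finite :=
        (g.map (algebraMap ℚ ℂ)).roots.toFinset.finite_toSet.sdiff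
      have hmem : ((((g.map (algebraMap ℚ ℂ)).roots.toFinset : Finset ℂ) : Set ℂ) \ {z})ᶜ ∈ 𝓝 z :=
        hfin.isClosed.isOpen_compl.mem_nhds (by simp)
      filter_upwards [hmem] with w hw hwz hwT
      exact hw ⟨hwT, hwz⟩
    rw [eventually_nhdsWithin_iff]
    filter_upwards [hK.mem_nhds hzK, hopen.mem_nhds hz, h3] with w hwK hwim hwT hwz
    rw [heq w hwim (hTg w (hwT hwz))]
    exact hB w hwK
  have hlim : Tendsto (fun w => ‖F' w‖) (𝓝[≠] z) (𝓝 ‖F' z‖) :=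
    ((hF'.continuousAt (hopen.mem_nhds hz)).tendsto.mono_left nhdsWithin_le_nhds).norm
  exact le_of_tendsto hlim hev

/-- **Far sheared lines miss the insides of all ovals** (compact real locus). [folklore] -/
theorem exists_forall_shearSlice_eq_empty (hcpt : IsCompact {v : Fin 2 → ℝ | aeval v p = 0}) (c : ℝ) :
    ∃ R₁ : ℝ, 0 ≤ R₁ ∧ ∀ O : Set (Fin 2 → ℝ),
      (∃ v : Fin 2 → ℝ, aeval v p = 0 ∧ O = connectedComponentIn {u : Fin 2 → ℝ | aeval u p = 0} v) →
      ∀ x : ℝ, R₁ < |x| → {t : ℝ | (![x + c * t, t] : Fin 2 → ℝ) ∈ ovalInterior O} = ∅ := by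
  obtain ⟨ρ, hρ⟩ := hcpt.isBounded.subset_closedBall 0
  refine ⟨max ρ 0 * (1 + |c|), by positivity, fun O hO x hx => ?_⟩
  ext t
  simp only [Set.mem_setOf_eq, Set.mem_empty_iff_false, iff_false]
  intro ht
  have hsub : ovalInterior O ⊆ closedBall 0 (max ρ 0) :=
    ovalInterior_subset_closedBall (le_max_right _ _)
      ((oval_subset_realLocus hO).trans (hρ.trans (closedBall_subset_closedBall (le_max_left _ _))))
  have hnorm : ‖(![x + c * t, t] : Fin 2 → ℝ)‖ ≤ max ρ 0 := mem_closedBall_zero_iff.1 (hsub ht)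
  have h1 : |t| ≤ max ρ 0 := (Slices.abs_le_norm_line x c t).trans hnorm
  have h0 : |x + c * t| ≤ max ρ 0 := by
    have h := norm_le_pi_norm (![x + c * t, t] : Fin 2 → ℝ) 0
    simp only [Matrix.cons_val_zero, Real.norm_eq_abs] at h
    exact h.trans hnorm
  have hct : |c * t| ≤ |c| * max ρ 0 := by
    rw [abs_mul]
    exact mul_le_mul_of_nonneg_left h1 (abs_nonneg c)
  have hxle : |x| ≤ max ρ 0 * (1 + |c|) := by
    calc |x| = |(x + c * t) - c * t| := by ring_nf
      _ ≤ |x + c * t| + |c * t| := abs_sub _ _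
      _ ≤ max ρ 0 + |c| * max ρ 0 := add_le_add h0 hct
      _ = max ρ 0 * (1 + |c|) := by ring
  linarith

/-- The slice-length function of the inside of a compact oval is integrable on bounded intervals
(measurable by Tonelli, bounded by the diameter). [folklore] -/
theorem intervalIntegrable_volume_shearSlice (c : ℝ) {O : Set (Fin 2 → ℝ)} (hO : IsCompact O)
    (a b : ℝ) :
    IntervalIntegrable (fun x : ℝ =>
      (volume {t : ℝ | (![x + c * t, t] : Fin 2 → ℝ) ∈ ovalInterior O}).toReal) volume a b := by
  obtain ⟨ρ, hρ⟩ := hO.isBounded.subset_closedBall 0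
  have hsub : ovalInterior O ⊆ closedBall 0 (max ρ 0) :=
    ovalInterior_subset_closedBall (le_max_right _ _)
      (hρ.trans (closedBall_subset_closedBall (le_max_left _ _)))
  have hmeas : Measurable fun x : ℝ =>
      (volume {t : ℝ | (![x + c * t, t] : Fin 2 → ℝ) ∈ ovalInterior O}).toReal :=
    (measurable_volume_shearSlice c (measurableSet_ovalInterior_of_isCompact hO)).ennreal_toReal
  have hbd : ∀ x : ℝ,
      ‖(volume {t : ℝ | (![x + c * t, t] : Fin 2 → ℝ) ∈ ovalInterior O}).toReal‖ ≤
        max ρ 0 - -max ρ 0 := by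
    intro x
    rw [Real.norm_eq_abs, abs_of_nonneg ENNReal.toReal_nonneg]
    exact ENNReal.toReal_le_of_le_ofReal (by linarith [le_max_right ρ 0]) (volume_shearSlice_le c hsub x)
  refine intervalIntegrable_iff.2 ⟨hmeas.aestronglyMeasurable,
    HasFiniteIntegral.restrict_of_bounded (max ρ 0 - -max ρ 0) ?_ (Eventually.of_forall hbd)⟩
  rw [Set.uIoc, Real.volume_Ioc]
  exact ENNReal.ofReal_lt_top

end Assembly

/-! ### The discharge -/

open Assembly in
/-- **Rokhlin's complex orientation formula, integrated** — discharge of the named fact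
`rokhlin_sum_sign_mul_area_ovalInterior_mem_algebraic_mul_pi` (Rokhlin 1974, §§2–3): for
`p ∈ ℚ[x, y]` with compact real zero locus, nonsingular complex affine curve, geometrically
irreducible and dividing, and a half `H`, the signed area sum
`Σ_O complexOrientationSign p H O · Area(ovalInterior O)` over the ovals is `β π` with `β` real
algebraic. Proof: module docstring (boundary values of the signed fibre sum on sheared lines,
Cavalieri, rectangle Cauchy, Puiseux expansion at infinity with algebraic coefficients,
uniqueness of divergent expansions); `β = -Σ_v η_v Im a_{v,N+n}`. [cite: Rokhlin1974, §§2–3] -/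
theorem rokhlin_sum_sign_mul_area_ovalInterior_mem_algebraic_mul_pi_holds :
    rokhlin_sum_sign_mul_area_ovalInterior_mem_algebraic_mul_pi := by
  intro p hcpt hsm hirr hdiv H hH
  -- ### the two halves
  have hA := isConnected_complexZeroLocus hirr
  have hN : nonRealLocus p = H ∪ star '' H :=
    Subset.antisymm (hH.nonRealLocus_subset_union_image_star hA.isPreconnected hsm)
      (union_subset hH.subset hH.image_star.subset)
  have hdisj : Disjoint H (star '' H) := hH.disjoint_image_star hA.isPreconnected hsm hdiv
  -- ### the shear and the normalised polynomial `Q`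
  have hp0 : p ≠ 0 := fun h => hirr.ne_zero (by rw [h, _root_.map_zero])
  obtain ⟨c, a, ha, -, hlead⟩ := ShearMonic.exists_shear_natDegree_eq (K := ℚ) hp0
  obtain ⟨Q, hQ⟩ : ∃ Q : Polynomial (Polynomial ℚ), Q = Polynomial.C (Polynomial.C a⁻¹) *
      aeval (![Polynomial.C Polynomial.X + Polynomial.C (Polynomial.C c) * Polynomial.X, Polynomial.X] :
        Fin 2 → Polynomial (Polynomial ℚ)) p := ⟨_, rfl⟩
  have hmonic : Q.Monic := by
    rw [hQ]
    refine Polynomial.monic_C_mul_of_mul_leadingCoeff_eq_one ?_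
    rw [hlead, ← Polynomial.C_mul, inv_mul_cancel₀ ha, Polynomial.C_1]
  have hirrQ : Irreducible (Q.map (Polynomial.mapRingHom (algebraMap ℚ ℂ))) := by
    rw [hQ]; exact irreducible_map_normalisedShear hirr c ha
  have hQp : ∀ ξ y : ℂ, (Q.map (Polynomial.eval₂RingHom (algebraMap ℚ ℂ) ξ)).eval y = 0 ↔
      aeval (![ξ + (c : ℂ) * y, y] : Fin 2 → ℂ) p = 0 := by
    intro ξ y
    rw [hQ]
    exact eval_map_normalisedShear_eq_zero_iff c ha ξ y
  have hQder : ∀ ξ y : ℂ, (c : ℂ) * aeval (![ξ + (c : ℂ) * y, y] : Fin 2 → ℂ) (pderiv 0 p) +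
        aeval (![ξ + (c : ℂ) * y, y] : Fin 2 → ℂ) (pderiv 1 p) = 0 →
      (Polynomial.derivative (Q.map (Polynomial.eval₂RingHom (algebraMap ℚ ℂ) ξ))).eval y = 0 := by
    intro ξ y h0
    rw [hQ, Polynomial.map_mul, Polynomial.map_C, Polynomial.derivative_C_mul, Polynomial.eval_mul,
      Polynomial.eval_C, eval_derivative_map_shear c ξ y, h0, mul_zero]
  have hd : 0 < Q.natDegree := by
    refine Nat.pos_of_ne_zero fun h0 => hirrQ.not_isUnit ?_
    rw [hmonic.natDegree_eq_zero] at h0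
    rw [h0, Polynomial.map_one]
    exact isUnit_one
  -- ### the signed fibre sum and its holomorphic version
  obtain ⟨F, hF⟩ : ∃ F : ℂ → ℂ, ∀ ξ : ℂ, F ξ =
      (((Q.map (Polynomial.eval₂RingHom (algebraMap ℚ ℂ) ξ)).roots.map fun y =>
        (if (![ξ + (c : ℂ) * y, y] : Fin 2 → ℂ) ∈ H then (1 : ℂ) else -1) * y)).sum := ⟨_, fun _ => rfl⟩
  obtain ⟨g, hg0, A, B, hbez⟩ := Sheets.exists_mul_add_mul_derivative_eq_C hmonic hirrQ
  obtain ⟨F', hF'd, hF'F⟩ := Sheets.exists_holomorphic_fibreSum hH hN hdisj hmonic hQp hF hg0 hbez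
  -- ### boundary values on the real axis
  have hbv : ∀ x : ℝ, ∃ L : ℂ, Polynomial.aeval (x : ℂ) g ≠ 0 →
      Tendsto (fun δ : ℝ => F' ((x : ℂ) + (δ : ℂ) * I)) (𝓝[>] 0) (𝓝 L) ∧
      L.re = -∑ O ∈ (finite_setOf_oval p).toFinset, (complexOrientationSign p H O : ℝ) *
        (volume {t : ℝ | (![x + (c : ℝ) * t, t] : Fin 2 → ℝ) ∈ ovalInterior O}).toReal := by
    intro x
    by_cases hg : Polynomial.aeval (x : ℂ) g = 0
    · exact ⟨0, fun h => absurd hg h⟩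
    obtain ⟨L, hL, hLre⟩ :=
      exists_boundaryValue_re hcpt hsm hirr hdiv hH hN hdisj hmonic hQp hQder hF hbez hg
    refine ⟨L, fun _ => ⟨?_, hLre⟩⟩
    have hF'lim : Tendsto F' (𝓝[{z : ℂ | 0 < z.im}] (x : ℂ)) (𝓝 L) := by
      refine hL.congr' ?_
      have hgne : ∀ᶠ z in 𝓝 (x : ℂ), Polynomial.aeval z g ≠ 0 :=
        (Polynomial.continuous_aeval g).continuousAt.eventually_ne hg
      filter_upwards [mem_nhdsWithin_of_mem_nhds hgne, self_mem_nhdsWithin] with z hz hzim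
      exact (hF'F z hzim hz).symm
    have hpath : Tendsto (fun δ : ℝ => (x : ℂ) + (δ : ℂ) * I) (𝓝[>] 0)
        (𝓝[{z : ℂ | 0 < z.im}] (x : ℂ)) := by
      refine tendsto_nhdsWithin_iff.2 ⟨?_, ?_⟩
      · have hc : Continuous (fun δ : ℝ => (x : ℂ) + (δ : ℂ) * I) := by fun_prop
        have h := hc.tendsto 0
        simp only [Complex.ofReal_zero, zero_mul, add_zero] at h
        exact h.mono_left nhdsWithin_le_nhds
      · filter_upwards [self_mem_nhdsWithin] with δ hδ
        simpa using hδ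
    exact hF'lim.comp hpath
  choose gfun hgfun using hbv
  -- all but finitely many real points are good
  have hgood : ∀ᵐ x : ℝ, Polynomial.aeval (x : ℂ) g ≠ 0 := by
    have hg0' : g.map (algebraMap ℚ ℂ) ≠ 0 :=
      (Polynomial.map_ne_zero_iff (algebraMap ℚ ℂ).injective).2 hg0
    have hfin : {x : ℝ | Polynomial.aeval (x : ℂ) g = 0}.Finite := by
      refine ((g.map (algebraMap ℚ ℂ)).roots.toFinset.finite_toSet.preimage
        Complex.ofReal_injective.injOn).subset ?_
      intro x hx
      simp only [Set.mem_preimage, Finset.mem_coe, Multiset.mem_toFinset]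
      rw [Polynomial.mem_roots hg0', Polynomial.IsRoot.def, Polynomial.eval_map, ← Polynomial.aeval_def]
      exact hx
    have h0 : volume {x : ℝ | Polynomial.aeval (x : ℂ) g = 0} = 0 := hfin.measure_zero volume
    rw [ae_iff]
    simpa using h0
  have hgtend : ∀ R : ℝ, ∀ᵐ x : ℝ, x ∈ uIoc (-R) R →
      Tendsto (fun δ : ℝ => F' ((x : ℂ) + (δ : ℂ) * I)) (𝓝[>] 0) (𝓝 (gfun x)) := by
    intro R
    filter_upwards [hgood] with x hx _ using (hgfun x hx).1
  -- ### Cauchy on rectangles: `∫_{-R}^{R} gfun = T(F', R)`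
  have hbound : ∀ R : ℝ, 0 < R → ∃ Bd : ℝ, ∀ z : ℂ, |z.re| ≤ R → 0 < z.im → z.im ≤ R → ‖F' z‖ ≤ Bd := by
    intro R hR
    obtain ⟨Bd, hBd⟩ := Sheets.exists_norm_fibreSum_le_of_isCompact hmonic hF
      (isCompact_closedBall (0 : ℂ) (2 * R + 1))
    refine ⟨Bd, fun z hzre hzim hzimR => norm_extension_le hg0 hF'd.continuousOn hF'F isOpen_ball
      (fun w hw => hBd w (ball_subset_closedBall hw)) hzim ?_⟩
    rw [mem_ball_zero_iff]
    calc ‖z‖ ≤ |z.re| + |z.im| := Complex.norm_le_abs_re_add_abs_im z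
      _ ≤ R + R := add_le_add hzre (by rw [abs_of_pos hzim]; exact hzimR)
      _ < 2 * R + 1 := by linarith
  have hE : ∀ R : ℝ, 0 < R → ∫ x in (-R : ℝ)..R, gfun x =
      (∫ x in (-R : ℝ)..R, F' (x + R * I)) - I • (∫ y in (0 : ℝ)..R, F' (R + y * I)) +
        I • (∫ y in (0 : ℝ)..R, F' (-R + y * I)) := by
    intro R hR
    obtain ⟨Bd, hBd⟩ := hbound R hR
    exact Literature.Analysis.Complex.BoundaryContour.integral_boundaryValues_eq_threeSides hR hF'd hBd (hgtend R)
  have hreInt : ∀ R : ℝ, 0 < R →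
      ∫ x in (-R : ℝ)..R, (gfun x).re = (∫ x in (-R : ℝ)..R, gfun x).re := by
    intro R hR
    obtain ⟨Bd, hBd⟩ := hbound R hR
    have hii := (Literature.Analysis.Complex.BoundaryContour.intervalIntegrable_of_boundaryValues hR hF'd.continuousOn hBd
      (hgtend R)).1
    have h := Complex.reCLM.intervalIntegral_comp_comm hii
    simpa using h
  -- ### the real parts of the boundary values are the signed slice lengths
  have hreInt2 : ∀ R : ℝ, ∫ x in (-R : ℝ)..R, (gfun x).re =
      -∑ O ∈ (finite_setOf_oval p).toFinset, (complexOrientationSign p H O : ℝ) *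
        ∫ x in (-R : ℝ)..R, (volume {t : ℝ | (![x + (c : ℝ) * t, t] : Fin 2 → ℝ) ∈ ovalInterior O}).toReal := by
    intro R
    have hae : ∀ᵐ x : ℝ, x ∈ uIoc (-R) R → (gfun x).re =
        -∑ O ∈ (finite_setOf_oval p).toFinset, (complexOrientationSign p H O : ℝ) *
          (volume {t : ℝ | (![x + (c : ℝ) * t, t] : Fin 2 → ℝ) ∈ ovalInterior O}).toReal := by
      filter_upwards [hgood] with x hx _ using (hgfun x hx).2
    rw [intervalIntegral.integral_congr_ae hae, intervalIntegral.integral_neg,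
      intervalIntegral.integral_finsetSum]
    · simp only [intervalIntegral.integral_const_mul]
    · intro O hO
      exact (intervalIntegrable_volume_shearSlice (c : ℝ)
        (isCompact_oval hcpt ((finite_setOf_oval p).mem_toFinset.1 hO)) _ _).const_mul _
  -- ### far lines miss the insides: for large `R` the slice integrals are the areas
  obtain ⟨R₁, hR₁0, hR₁⟩ := exists_forall_shearSlice_eq_empty hcpt (c : ℝ)
  have harea : ∀ O ∈ (finite_setOf_oval p).toFinset, ∀ R : ℝ, R₁ < R →
      ∫ x in (-R : ℝ)..R, (volume {t : ℝ | (![x + (c : ℝ) * t, t] : Fin 2 → ℝ) ∈ ovalInterior O}).toReal =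
        (volume (ovalInterior O)).toReal := by
    intro O hO R hR
    have hO' := (finite_setOf_oval p).mem_toFinset.1 hO
    rw [volume_ovalInterior_toReal_eq_integral_shearSlice (c : ℝ) hcpt hO']
    apply intervalIntegral.integral_eq_integral_of_support_subset
    intro x hx
    simp only [Function.mem_support, ne_eq] at hx
    have hxR : |x| ≤ R₁ := by
      by_contra hlt
      rw [not_le] at hlt
      apply hx
      rw [hR₁ O hO' x hlt, measure_empty, ENNReal.toReal_zero]
    obtain ⟨h1, h2⟩ := abs_le.1 hxR
    exact ⟨by linarith, by linarith⟩
  -- ### at infinity: `F'` is a signed sum of Puiseux branches with algebraic coefficients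
  obtain ⟨n, hn, N, S, Nv, ρ, r, η, R₀, hr, -, hNv, hρ, hη1, hFsum⟩ :=
    Sheets.exists_fibreSum_eq_puiseuxSum hH hN hdisj hmonic hirrQ hd hQp hF
  obtain ⟨Rg, hRg⟩ : ∃ Rg : ℝ, ∀ z : ℂ, Rg ≤ ‖z‖ → Polynomial.aeval z g ≠ 0 := by
    have hg0' : g.map (algebraMap ℚ ℂ) ≠ 0 :=
      (Polynomial.map_ne_zero_iff (algebraMap ℚ ℂ).injective).2 hg0
    refine ⟨(∑ w ∈ (g.map (algebraMap ℚ ℂ)).roots.toFinset, ‖w‖) + 1, fun z hz h0 => ?_⟩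
    have hmem : z ∈ (g.map (algebraMap ℚ ℂ)).roots.toFinset := by
      rw [Multiset.mem_toFinset, Polynomial.mem_roots hg0', Polynomial.IsRoot.def, Polynomial.eval_map,
        ← Polynomial.aeval_def]
      exact h0
    have hle : ‖z‖ ≤ ∑ w ∈ (g.map (algebraMap ℚ ℂ)).roots.toFinset, ‖w‖ :=
      Finset.single_le_sum (fun w _ => norm_nonneg w) hmem
    linarith
  have hΦ := fun (u : ℂ) (hu : 0 < u.im) (hRu : max R₀ Rg ≤ ‖u‖) =>
    (hF'F u hu (hRg u ((le_max_right _ _).trans hRu))).trans (hFsum u hu ((le_max_left _ _).trans hRu))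
  obtain ⟨cQ, hcQ⟩ := Literature.Analysis.Complex.BoundaryContour.tendsto_re_threeSides_puiseuxSum S η
    (fun v i => algebraMap (algebraicClosure ℚ ℂ) ℂ (PowerSeries.coeff i v)) Nv ρ hn (max R₀ Rg) hr
    hNv hρ F' hΦ
  -- ### names for the three-sides integral, the constant term and the signed area sum
  obtain ⟨Tre, hTre⟩ : ∃ Tre : ℝ → ℝ, ∀ R : ℝ, Tre R =
      ((∫ x in (-R : ℝ)..R, F' (x + R * I)) - I • (∫ y in (0 : ℝ)..R, F' (R + y * I)) +
        I • (∫ y in (0 : ℝ)..R, F' (-R + y * I))).re := ⟨_, fun _ => rfl⟩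
  obtain ⟨Cst, hCst⟩ : ∃ Cst : ℝ, Cst = Real.pi * ∑ v ∈ S,
      η v * (algebraMap (algebraicClosure ℚ ℂ) ℂ (PowerSeries.coeff (N + n) v)).im := ⟨_, rfl⟩
  obtain ⟨Lst, hLst⟩ : ∃ Lst : ℝ, Lst = -∑ O ∈ (finite_setOf_oval p).toFinset,
      (complexOrientationSign p H O : ℝ) * (volume (ovalInterior O)).toReal := ⟨_, rfl⟩
  simp only [← hTre, ← hCst] at hcQ
  -- ### the boundary integral is eventually the constant `Lst`
  have hev : ∀ᶠ R : ℝ in atTop,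
      ∑ i ∈ Finset.range (N + n), R ^ (((N : ℝ) - i) / n + 1) * cQ i + Cst +
        (Tre R - ∑ i ∈ Finset.range (N + n), R ^ (((N : ℝ) - i) / n + 1) * cQ i - Cst) = Lst := by
    filter_upwards [eventually_gt_atTop (max R₁ 0)] with R hR
    have hR0 : 0 < R := lt_of_le_of_lt (le_max_right _ _) hR
    have hR1 : R₁ < R := lt_of_le_of_lt (le_max_left _ _) hR
    have key : Tre R = Lst := by
      rw [hTre, ← hE R hR0, ← hreInt R hR0, hreInt2 R, hLst]
      congr 1
      refine Finset.sum_congr rfl fun O hO => ?_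
      rw [harea O hO R hR1]
    rw [key]
    ring
  have hexp : ∀ i ∈ Finset.range (N + n), 0 < ((N : ℝ) - i) / n + 1 := by
    intro i hi
    have hi' : (i : ℝ) < N + n := by exact_mod_cast Finset.mem_range.1 hi
    have hn' : (0 : ℝ) < n := by exact_mod_cast hn
    rw [div_add_one hn'.ne']
    exact div_pos (by linarith) hn'
  have hconcl := eq_of_eventually_sum_rpow_mul_eq (Finset.range (N + n))
    (fun i : ℕ => ((N : ℝ) - i) / n + 1) hexp cQ Cst Lst
    (fun R => Tre R - ∑ i ∈ Finset.range (N + n), R ^ (((N : ℝ) - i) / n + 1) * cQ i - Cst) hcQ hev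
  -- ### conclusion
  refine ⟨-∑ v ∈ S, η v * (algebraMap (algebraicClosure ℚ ℂ) ℂ (PowerSeries.coeff (N + n) v)).im,
    ?_, ?_⟩
  · refine IsAlgebraic.neg ?_
    refine Finset.sum_induction _ (fun b : ℝ => IsAlgebraic ℚ b) (fun a b ha hb => ha.add hb)
      isAlgebraic_zero fun v hv => ?_
    have hηv : IsAlgebraic ℚ (η v) := by
      rcases hη1 v hv with h | h <;> rw [h]
      · exact isAlgebraic_one
      · exact isAlgebraic_one.neg
    exact hηv.mul (isAlgebraic_im
      (Literature.FieldTheory.AlgClosed.PuiseuxInfinityAlgebraic.isAlgebraic_algebraMap_algebraicClosure _))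
  · rw [finsum_mem_setOf_oval_eq_sum p]
    have h1 : ∑ O ∈ (finite_setOf_oval p).toFinset,
        (complexOrientationSign p H O : ℝ) * (volume (ovalInterior O)).toReal = -Lst := by
      rw [hLst, neg_neg]
    rw [h1, hconcl, hCst]
    ring

end Literature.AlgebraicGeometry.RealAlgebraic
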